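import Literature.AlgebraicGeometry.Motives.MumfordTateGroupOfOrientationSerreGroupSplittingField
import HarnessLib

/-!
# THE REFLEX FIELD IS THE LEAST LEVEL: for a CM type `Φ` of a CM field `F`, `E* = E*(F,Φ) ⊂ ℚ^{cm}` is itself a level, `λ̄^Φ ∈ X^*(S^{E*})`,
# and `E*` is the SMALLEST `E ⊂ ℚ^{cm}` with `X^*(MT(V¹_{(F,Φ)})) ⊆ X^*(S^E)`; hence `ρ_{Π(Φ)}` factors through `S^{E*}`
# (Milne–Shih, LNM 900 III §1 (1.5)–(1.6); Milne, *Complex Multiplication* I §1 Prop. 1.18 (a), §4 Prop. 4.21; Shimura §8.3 Prop. 28)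

[topic AlgebraicGeometry/Motives]

Layer `Literature/AlgebraicGeometry/Motives`, lane `lit-hodgefound` (Track 2 foundations library; seat `lit-hodgefound-p02`, gen 32, row g32-#12).
One plumbing definition with body (`traceLevel Φ` = `E*` read inside `ℚ^{cm}`) and theorems; NO named fact (D-0026 net debt `0`).  Removes the
HONEST-SCOPE caveat of g32-#11 (`Motives/MumfordTateGroupOfOrientationSerreGroupSplittingField`: `galSpan(λ̄) ⊆ Λ^E ⟺ traceField Φ ≤ E`, for
`E` GIVEN inside `ℚ^{cm}`) using the tree's `isCMField_traceField` (the reflex field of a CM type of a CM field is CM; p2x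
`NumberTheory/ComplexMultiplication/CMAlgebraReflexField`), `finiteDimensional_traceField` (`NumberTheory/ComplexMultiplication/ReflexNormDeterminant`)
and p27's `le_cmNumbers_of_isCMField` (`NumberTheory/NumberFields/CMNumbers`); the factorisation is g32-#10's `serreToGLLevel`.

THE PRINTS.  J. S. Milne, K.-y. Shih [MilneShih1982Taniyama] III §1 (held text `book:deligne1982-hodge-cycles-motives-shimura-varieties` p. 165):
(1.5) p. 232 «pairs `(T,μ)` … `T` split over `L` and `μ` defined over `L`»; (1.6) p. 232 «`λ ∈ X^*(S^L)` … `T^λ` the quotient of `S^L` …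
`MT(V,h) = T^λ`».  J. S. Milne, *Complex Multiplication* (2006) [MilneCM2006] Ch. I §1 Prop. 1.18 (a) («`E*` is a CM field»), Def. 1.17, §4
Prop. 4.21; §1 Rem. 1.6 (`ℚ^{cm}` = the union of all CM fields).  G. Shimura [Shimura1998] §8.3 Prop. 28 (`K* = ℚ(Σ ξ^{φᵢ})` is a CM field).

THE MECHANISM.  `E* = traceField Φ ⊂ ℂ` is a CM number field (tree), hence `E* ⊆ ℚ^{cm}` (p27); read it as an intermediate field
`traceLevel Φ` of `ℚ^{cm}/ℚ` (Mathlib's `IntermediateField.restrict`, `lift (traceLevel Φ) = traceField Φ`).  g32-#11's criterion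
`galSpan(λ̄_{θ₁}) ⊆ Λ^E ⟺ traceField Φ ≤ lift E` then reads `⟺ traceLevel Φ ≤ E`: the admissible levels form the principal up-set of `E*`,
so `E*` is the least one and in particular admissible — `λ̄^Φ_θ ∈ X^*(S^{E*})`, `ρ_{Π(Φ)} = ρ^{E*} ∘ (S ↠ S^{E*})`.

WHAT IS PROVED (`F` a CM field, `Φ : CMType F`, `hpol` the polarizability witness of `Ξ(F,Π(Φ)) = V¹_{(F,Φ)}`).
`traceField_le_cmNumbers` (`E*(F,Φ) ⊆ ℚ^{cm}`), DEF `traceLevel Φ`, `lift_traceLevel`, `mem_traceLevel_iff`, `lift_le_lift_iff_le`,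
**`mtCharCM_ofCMType_mem_lambdaLevel_traceLevel`** (`λ̄^Φ_θ ∈ Λ^{E*}`), **`galSpan_mtCharCM_ofCMType_le_lambdaLevel_iff_traceLevel_le`**
(`X^*(T^λ) ⊆ X^*(S^E) ⟺ E* ≤ E`), **`galSpan_mtCharCM_ofCMType_le_lambdaLevel_traceLevel`**, **`isLeast_traceLevel`** (`E*` is the LEAST
admissible level), **`exists_serreToGLLevel_traceLevel`** (`ρ_{Π(Φ)}` factors through `S^{E*}`, onto `MT(V¹_{(F,Φ)})(ℂ)`, `ρ^{E*} ∘ μ^{E*} = μ`).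

HONEST SCOPE.  CM types of CM FIELDS only (for a general polarizable orientation the reflex field is not placed inside `ℚ^{cm}` here);
`E*` is Shimura's trace field `ℚ(tr_Φ) ⊂ ℂ`; points/characters only, as in g32-#10/#11.

## References
* [MilneShih1982Taniyama] J. S. Milne, K.-y. Shih, *Langlands's construction of the Taniyama group*, in LNM 900 (1982), art. III §1 (1.5)–(1.6)
  p. 232 (held text p. 165).
* [MilneCM2006] J. S. Milne, *Complex Multiplication* (course notes, 2006), Ch. I §1 Rem. 1.6, Def. 1.17, Prop. 1.18 (a); §4 Prop. 4.21.
* [Shimura1998] G. Shimura, *Abelian Varieties with Complex Multiplication and Modular Functions*, Princeton UP (1998), §8.3 Prop. 28.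

## Provenance
Lane `lit-hodgefound` (Hodge path, Track 2), prover seat `lit-hodgefound-p02` (generation 32), self-proposed row g32-#12 (closes g32-#11's caveat).
-/

noncomputable section

open scoped TensorProduct Classical
open Module NumberField

namespace Literature.AlgebraicGeometry.Motives

namespace HodgeStructure

namespace Orientation

open Literature.NumberTheory.ComplexMultiplication
open Literature.NumberTheory.ComplexMultiplication.CMNumbers
open Literature.NumberTheory.NumberFields (cmNumbers le_cmNumbers_of_isCMField)

variable {K : Type} [Field K] [NumberField K] [IsCMField K] (Φ : CMType K)

/-- **`E*(F,Φ) ⊆ ℚ^{cm}`**: the reflex field of a CM type of a CM field is a CM field (tree: `isCMField_traceField`), and `ℚ^{cm}` contains every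
CM subfield of `ℂ` finite over `ℚ` (p27 `le_cmNumbers_of_isCMField`). [cite: MilneCM2006, Ch. I §1 Prop. 1.18 (a), Rem. 1.6] [cite: Shimura1998, §8.3 Prop. 28] -/
theorem traceField_le_cmNumbers : traceField Φ ≤ cmNumbers :=
  le_cmNumbers_of_isCMField (traceField Φ) (isCMField_traceField K Φ)

/-- **`E* = E*(F,Φ)` as a level of `ℚ^{cm}`** (the trace field restricted into `ℚ^{cm}`, Mathlib's `IntermediateField.restrict`).
[cite: MilneShih1982Taniyama, III §1 (1.5)–(1.6) (p. 232)] [cite: MilneCM2006, Ch. I §1 Def. 1.17] -/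
def traceLevel : IntermediateField ℚ cmNumbers :=
  IntermediateField.restrict (traceField_le_cmNumbers Φ)

/-- `E*` read back in `ℂ` is the trace field. [cite: MilneCM2006, Ch. I §1 Def. 1.17] -/
theorem lift_traceLevel : IntermediateField.lift (traceLevel Φ) = traceField Φ :=
  IntermediateField.lift_restrict _

/-- Membership in `traceLevel`. [cite: MilneCM2006, Ch. I §1 Def. 1.17] -/
theorem mem_traceLevel_iff (x : cmNumbers) : x ∈ traceLevel Φ ↔ (x : ℂ) ∈ traceField Φ :=
  IntermediateField.mem_restrict _ x

omit [IsCMField K] Φ in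
/-- `lift` is an order embedding on the levels of `ℚ^{cm}`: `lift E₁ ≤ lift E₂ ⟺ E₁ ≤ E₂`. [folklore] -/
private theorem lift_le_lift_iff_le (E₁ E₂ : IntermediateField ℚ cmNumbers) :
    IntermediateField.lift E₁ ≤ IntermediateField.lift E₂ ↔ E₁ ≤ E₂ :=
  ⟨fun h x hx => (IntermediateField.mem_lift x).mp (h ((IntermediateField.mem_lift x).mpr hx)),
    fun h => IntermediateField.map_mono _ h⟩

/-- **`X^*(T^λ) ⊆ X^*(S^E) ⟺ E* ≤ E`** for levels `E ⊂ ℚ^{cm}` (g32-#11's criterion with `E*` itself a level).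
[cite: MilneShih1982Taniyama, III §1 (1.5)–(1.6) (p. 232)] [cite: MilneCM2006, Ch. I §1 Def. 1.17, §4 Prop. 4.21] -/
theorem galSpan_mtCharCM_ofCMType_le_lambdaLevel_iff_traceLevel_le (hpol : (ofOrientation (Orientation.ofCMType Φ)).IsPolarizable)
    (θ₁ : K →+* ℂ) (E : IntermediateField ℚ cmNumbers) :
    galSpan ((Orientation.ofCMType Φ).mtCharCM θ₁) ≤ lambdaLevel E ↔ traceLevel Φ ≤ E := by
  rw [galSpan_mtCharCM_ofCMType_le_lambdaLevel_iff_traceField_le Φ hpol θ₁ E, ← lift_traceLevel Φ, lift_le_lift_iff_le]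

/-- **`λ̄^Φ_θ ∈ Λ^{E*} = X^*(S^{E*})`**: the descended Mumford–Tate characters of `V¹_{(F,Φ)}` come from the level `S^{E*}` of the reflex field.
[cite: MilneShih1982Taniyama, III §1 (1.6) (p. 232) («λ ∈ X^*(S^L)»)] [cite: MilneCM2006, Ch. I §4 Prop. 4.21] -/
theorem mtCharCM_ofCMType_mem_lambdaLevel_traceLevel (hpol : (ofOrientation (Orientation.ofCMType Φ)).IsPolarizable) (θ : K →+* ℂ) :
    (Orientation.ofCMType Φ).mtCharCM θ ∈ lambdaLevel (traceLevel Φ) :=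
  (mtCharCM_ofCMType_mem_lambdaLevel_iff_traceField_le Φ hpol θ (traceLevel Φ)).mpr (lift_traceLevel Φ).ge

/-- **`X^*(MT(V¹_{(F,Φ)})) = galSpan(λ̄_{θ₁}) ⊆ X^*(S^{E*})`**: `T^λ` is a quotient of `S^{E*}`. [cite: MilneShih1982Taniyama, III §1 (1.6) (p. 232)] -/
theorem galSpan_mtCharCM_ofCMType_le_lambdaLevel_traceLevel (hpol : (ofOrientation (Orientation.ofCMType Φ)).IsPolarizable)
    (θ₁ : K →+* ℂ) : galSpan ((Orientation.ofCMType Φ).mtCharCM θ₁) ≤ lambdaLevel (traceLevel Φ) :=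
  (galSpan_mtCharCM_ofCMType_le_lambdaLevel_iff_traceLevel_le Φ hpol θ₁ _).mpr le_rfl

/-- **`E*` IS THE LEAST LEVEL `E ⊂ ℚ^{cm}` with `X^*(MT(V¹_{(F,Φ)})) ⊆ X^*(S^E)`** — the smallest field of definition of `(T^λ, μ^λ)`.
[cite: MilneShih1982Taniyama, III §1 (1.5)–(1.6) (p. 232)] [cite: MilneCM2006, Ch. I §1 Def. 1.17, §4 Prop. 4.21]
[cite: CattaniElZeinGriffithsLe2014, Ch. 12 (M. Kerr) §12.5.A Examples 12.5.2 (a)] -/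
theorem isLeast_traceLevel (hpol : (ofOrientation (Orientation.ofCMType Φ)).IsPolarizable) (θ₁ : K →+* ℂ) :
    IsLeast {E : IntermediateField ℚ cmNumbers | galSpan ((Orientation.ofCMType Φ).mtCharCM θ₁) ≤ lambdaLevel E} (traceLevel Φ) :=
  ⟨galSpan_mtCharCM_ofCMType_le_lambdaLevel_traceLevel Φ hpol θ₁,
    fun E hE => (galSpan_mtCharCM_ofCMType_le_lambdaLevel_iff_traceLevel_le Φ hpol θ₁ E).mp hE⟩

/-- **`ρ_{Π(Φ)}` FACTORS THROUGH `S^{E*}`**: g32-#10's `ρ^{E*} : S^{E*}(ℂ) → GL(V_ℂ)` with `ρ^{E*} ∘ (S ↠ S^{E*}) = ρ_{Π(Φ)}`, image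
`MT(V¹_{(F,Φ)})(ℂ)`, and `ρ^{E*} ∘ μ^{E*} = μ_{Π(Φ)}` — Milne–Shih's `ρ_μ : S^L → T` at the least possible `L`.
[cite: MilneShih1982Taniyama, III §1 (1.3) (p. 231), (1.6) (p. 232)] [cite: MilneCM2006, Ch. I §4 Prop. 4.21] -/
theorem exists_serreToGLLevel_traceLevel [HodgeTensorFacts.{0, 0}] (hpol : (ofOrientation (Orientation.ofCMType Φ)).IsPolarizable)
    (θ₁ : K →+* ℂ) :
    ∃ ρE : serreLevelPoints ℂ (traceLevel Φ) →* ((ℂ ⊗[ℚ] K) ≃ₗ[ℂ] (ℂ ⊗[ℚ] K)),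
      ρE.comp (toLevel ℂ (traceLevel Φ)) = (Orientation.ofCMType Φ).serreToGL hpol ∧
        ρE.range = (ofOrientation (Orientation.ofCMType Φ)).mumfordTateGroupBaseChange ℂ ∧
          ∀ z : ℂˣ, ρE (muLevelPoints ℂ (traceLevel Φ) z) = (ofOrientation (Orientation.ofCMType Φ)).hodgeCocharacter z :=
  exists_serreToGLLevel_of_traceField_le Φ hpol θ₁ (traceLevel Φ) (lift_traceLevel Φ).ge

end Orientation

end HodgeStructure

end Literature.AlgebraicGeometry.Motives
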